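import Literature.Analysis.FluidPDE.BiotSavartIntegral
import Literature.Analysis.FluidPDE.BiotSavartNewtonKernel
import Literature.Analysis.FluidPDE.VorticityCalculus
import Literature.Analysis.FluidPDE.VectorCalculusProofs
import Literature.Analysis.FluidPDE.SpaceTimeCalculusC1
import Literature.Analysis.FluidPDE.ChenHouContinuation
import HarnessLib

/-!
# Decay of the time derivative of a classical Euler solution with compactly supported
vorticity (the far field of `∂ₜ(K₃ ∗ ω)`)

Topic `Literature/Analysis/FluidPDE` (all results proved, no definitions). Brick **(C)** of the
decomposition of the named fact
`Literature.Analysis.FluidPDE.MajdaBertozzi2002_holderEulerUniqueness`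
(`ElgindiAprioriBlowupProofs.lean`; plan in `EulerDecayUniqueness.lean`, brick (D)): the energy
method `IsClassicalEulerOnDomain.eq_of_decay` needs `|∂ₜuᵢ(s, x)| ≲ (1 + |x|)⁻²` uniformly on a
compact time interval. In the Hölder class this is not a hypothesis but a consequence of the
Biot–Savart representation of the slices (brick (A), `biotSavart_curl_eq_self`, Majda–Bertozzi
Prop. 2.16 and (4.4): `v(x,t) = ∫ K₃(x − x') ω(x', t) dx'`) and of the boundedness of the support
of the vorticity on compact time intervals (brick (B)); this file proves that implication:

* `IsClassicalEulerOnDomain.exists_norm_timeDerivWithin_le`: for a classical Euler solution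
  (`C¹` jointly, zero force) on `ℝ³ × [0, T)` whose slices on `[0, T₁]`, `T₁ < T`, satisfy
  `u(s) = K₃ ∗ curl u(s)`, `supp curl u(s) ⊆ B̄(0, R)` and `|u|, |∇u| ≤ U`, there is `C` with
  `‖∂ₜu(s, x)‖ ≤ C (1 + ‖x‖)⁻²` on `[0, T₁] × ℝ³`.

The proof is Eulerian and avoids the (non-existent) time derivative of `ω = curl u` for `C¹`
velocities: for `|x| ≥ 4R'` (`R' = max(R,1)`) and a vector `a`,
`⟪a, u(r, x)⟫ = ∫ ⟪K(y − x) a, ω(r, y)⟫ dy = ∫ ⟪u(r, y), curl A_{x,a}(y)⟫ dy` with the smooth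
compactly supported test field `A_{x,a}(y) = χ_{R'}(y) K(y − x) a` (the curl moved onto the test
field, `integral_inner_curl_eq_integral_inner_curl`); this is differentiated in time under the
integral sign, the momentum equation `∂ₜu = −∇p − (u·∇)u` is inserted, the pressure term drops
out (`∫ ⟪∇p, curl A⟫ = −∫ p div curl A = 0`, `divergence_curl_eq_zero_holds`), and
`|∫ ⟪(u·∇)u, curl A_{x,a}⟫| ≤ U² ∫ |curl A_{x,a}| ≲ |x|⁻²` because on the support of `χ_{R'}`,
`|y − x| ≥ |x|/2`, `|K(z)| ≲ |z|⁻²`, `|DK(z)| ≲ |z|⁻³` (homogeneity of degree `−2`,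
Majda–Bertozzi (4.30)–(4.31)). Near the origin `∂ₜu` is bounded by continuity on a compact set,
and the endpoints `s = 0, T₁` follow by continuity in time.

## Main statements (all proved)

* `contDiffAt_biotSavartKernel_left`, `biotSavartKernel_smul_left` (homogeneity of degree `−2`),
  `exists_norm_fderiv_biotSavartKernel_le` (`|D_z K(z)a| ≤ M |z|⁻³` for `|z| ≥ 1`);
* `contDiff_smul_of_tsupport_subset` (cutting off a field smooth near the support of the
  cut-off), the test field `y ↦ χ_{R'}(y) K(y − x) a`: smoothness, support, and
  `exists_norm_curl_cutoff_smul_biotSavartKernel_sub_le` (`|curl A_{x,a}| ≤ B |x|⁻²`);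
* `inner_eq_integral_inner_curl_testField` (`⟪a, v(x)⟫ = ∫ ⟪v, curl A_{x,a}⟫` for
  `v = K₃ ∗ curl v` with `supp curl v ⊆ B̄(0, R')`, `|x| ≥ 4R'`);
* `hasDerivAt_integral_inner_of_contDiffOn` (time derivative of `∫ ⟪u(r, ·), B⟫`);
* `IsClassicalEulerOnDomain.exists_norm_timeDerivWithin_le` (the decay of `∂ₜu`).

Tree/Mathlib search: no time-derivative decay for Biot–Savart velocities in the tree
(`lean search 'timeDeriv.*biotSavart|biotSavart.*decay'`: only `BiotSavartBounds.lean`, the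
spatial decay `norm_biotSavart_le_bracket`). Used from the tree: `biotSavartKernel_eq_smul_crossCLM`,
`inner_biotSavartKernel_left`, `integrable_biotSavartKernel_sub_apply` (`BiotSavartIntegral`),
`norm_biotSavartKernel_le` (`BiotSavartBounds`), `fderiv_homogeneous`,
`exists_bound_of_homogeneous` (`NewtonKernel`), `curl_smul`, `norm_curl_le`,
`norm_curlCLM_smulRight_le`, `contDiff_curl`, `integral_inner_curl_eq_integral_inner_curl`
(`VorticityCalculus`), `divergence_curl_eq_zero_holds` (`VectorCalculusProofs`), `cutoff`,
`exists_norm_fderiv_cutoff_le`, `integral_inner_gradient_eq_neg_integral_mul_divergence`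
(`WholeSpaceIBP`), `hasDerivAt_integral_of_contDiffOn`, `continuousOn_timeDerivWithin_of_contDiffOn`
(`SpaceTimeCalculusC1`); from Mathlib `contDiffAt_norm`, `fderiv_comp_sub`,
`IsCompact.exists_bound_of_continuousOn`, `HasDerivAt.unique`, `le_on_closure`.

## References

* A. J. Majda, A. L. Bertozzi, *Vorticity and Incompressible Flow* (CUP 2002), §3.1.1 p. 87
  ("vanish sufficiently rapidly as `|x| ↗ ∞`"), §4.1 eqs. (4.4), (4.30)–(4.31), Lemma 4.5
  (held text pp. 124–129). [MajdaBertozziCUP2002]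
-/

noncomputable section

open MeasureTheory Set Function Filter Topology InnerProductSpace Metric
open scoped RealInnerProductSpace

namespace Literature.Analysis.FluidPDE

/-! ### The Biot–Savart kernel away from its singularity: smoothness, homogeneity, decay of the
derivative -/

/-- The Biot–Savart kernel `z ↦ K(z) h = (4π‖z‖³)⁻¹ (h × z)` is smooth away from the origin. [folklore] -/
theorem contDiffAt_biotSavartKernel_left {z : (EuclideanSpace ℝ (Fin 3))} (hz : z ≠ 0) (h : (EuclideanSpace ℝ (Fin 3))) {n : WithTop ℕ∞} :
    ContDiffAt ℝ n (fun z => biotSavartKernel z h) z := by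
  have e : (fun z => biotSavartKernel z h) = fun z => (4 * Real.pi * ‖z‖ ^ 3)⁻¹ • crossCLM h z :=
    funext fun z => biotSavartKernel_eq_smul_crossCLM z h
  rw [e]
  have h1 : ContDiffAt ℝ n (fun z : (EuclideanSpace ℝ (Fin 3)) => (4 * Real.pi * ‖z‖ ^ 3)⁻¹) z := by
    refine ((contDiffAt_const.mul ((contDiffAt_norm ℝ hz).pow 3)).inv ?_)
    have : 0 < ‖z‖ := norm_pos_iff.2 hz
    positivity
  exact h1.smul (crossCLM h).contDiff.contDiffAt

/-- The kernel is smooth on the complement of the origin. [folklore] -/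
theorem contDiffOn_biotSavartKernel_left (h : (EuclideanSpace ℝ (Fin 3))) {n : WithTop ℕ∞} :
    ContDiffOn ℝ n (fun z => biotSavartKernel z h) {0}ᶜ := fun _ hz =>
  (contDiffAt_biotSavartKernel_left hz h).contDiffWithinAt

/-- **Homogeneity of degree `−2`**: `K(c z) h = c⁻² K(z) h` for `c > 0` (Majda–Bertozzi (4.30):
`K_N(λx) = λ^{1−N} K_N(x)`). [cite: MajdaBertozziCUP2002, §4.1.3 eq. (4.30) (p. 128)] -/
theorem biotSavartKernel_smul_left {c : ℝ} (hc : 0 < c) (z h : (EuclideanSpace ℝ (Fin 3))) :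
    biotSavartKernel (c • z) h = c ^ (-2 : ℤ) • biotSavartKernel z h := by
  rw [biotSavartKernel_eq_smul_crossCLM, biotSavartKernel_eq_smul_crossCLM, map_smul, norm_smul,
    Real.norm_of_nonneg hc.le, smul_smul, smul_smul]
  rcases eq_or_ne z 0 with rfl | hz
  · simp
  have hz' : 0 < ‖z‖ := norm_pos_iff.2 hz
  congr 1
  rw [zpow_neg, zpow_ofNat]
  field_simp

/-- **Decay of the derivative of the kernel**: `‖D_z(K(·) h)(z)‖ ≤ M ‖z‖⁻³` for `‖z‖ ≥ 1` (the
derivative is homogeneous of degree `−3` and continuous on the unit sphere; Majda–Bertozzi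
(4.31): `P_N = ∇K_N` is homogeneous of degree `−N`). [cite: MajdaBertozziCUP2002, §4.1.3 eq. (4.31) (p. 128)] -/
theorem exists_norm_fderiv_biotSavartKernel_le (h : (EuclideanSpace ℝ (Fin 3))) :
    ∃ M : ℝ, 0 ≤ M ∧ ∀ z : (EuclideanSpace ℝ (Fin 3)), 1 ≤ ‖z‖ →
      ‖fderiv ℝ (fun z => biotSavartKernel z h) z‖ ≤ M * (‖z‖ ^ 3)⁻¹ := by
  set F : (EuclideanSpace ℝ (Fin 3)) → (EuclideanSpace ℝ (Fin 3)) := fun z => biotSavartKernel z h with hF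
  have hhom : ∀ c : ℝ, 0 < c → ∀ z, F (c • z) = c ^ (-2 : ℤ) • F z := fun c hc z =>
    biotSavartKernel_smul_left hc z h
  have hD : ∀ c : ℝ, 0 < c → ∀ z, fderiv ℝ F (c • z) = c ^ ((-2 : ℤ) - 1) • fderiv ℝ F z :=
    fderiv_homogeneous F (-2) hhom
  have hcont : ContinuousOn (fderiv ℝ F) {0}ᶜ :=
    (contDiffOn_biotSavartKernel_left h (n := 1)).continuousOn_fderiv_of_isOpen
      isOpen_compl_singleton le_rfl
  obtain ⟨M, hM⟩ := exists_bound_of_homogeneous (fderiv ℝ F) ((-2 : ℤ) - 1) (by norm_num) hD hcont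
    one_pos
  have hM0 : 0 ≤ M := by
    have := hM (EuclideanSpace.single 0 1) (by simp)
    exact (norm_nonneg _).trans this
  refine ⟨M, hM0, fun z hz => ?_⟩
  have hz0 : 0 < ‖z‖ := one_pos.trans_le hz
  set w : (EuclideanSpace ℝ (Fin 3)) := ‖z‖⁻¹ • z with hw
  have hwn : ‖w‖ = 1 := by
    rw [hw, norm_smul, norm_inv, norm_norm, inv_mul_cancel₀ hz0.ne']
  have hzw : z = ‖z‖ • w := by rw [hw, smul_smul, mul_inv_cancel₀ hz0.ne', one_smul]
  have key := hD ‖z‖ hz0 w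
  rw [← hzw] at key
  rw [key, norm_smul, norm_zpow, Real.norm_of_nonneg hz0.le,
    show ((-2 : ℤ) - 1) = -3 by norm_num, zpow_neg, zpow_ofNat, mul_comm]
  exact mul_le_mul_of_nonneg_right (hM w (by rw [hwn])) (by positivity)

/-! ### Smooth fields obtained by cutting off a field which is smooth near the support of the
cut-off -/

section SmoothCutoff

variable {E : Type*} [NormedAddCommGroup E] [NormedSpace ℝ E]
variable {F : Type*} [NormedAddCommGroup F] [NormedSpace ℝ F]

/-- If `χ` is `Cⁿ` with `tsupport χ ⊆ U`, `U` open, and `G` is `Cⁿ` on `U`, then `χ • G` is `Cⁿ`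
everywhere (it vanishes near every point outside `U`). [folklore] -/
theorem contDiff_smul_of_tsupport_subset {χ : E → ℝ} {G : E → F} {U : Set E} {n : WithTop ℕ∞}
    (hU : IsOpen U) (hχ : ContDiff ℝ n χ) (hsupp : tsupport χ ⊆ U) (hG : ContDiffOn ℝ n G U) :
    ContDiff ℝ n fun y => χ y • G y := by
  refine contDiff_iff_contDiffAt.2 fun y => ?_
  by_cases hy : y ∈ U
  · exact hχ.contDiffAt.smul (hG.contDiffAt (hU.mem_nhds hy))
  · have hy' : y ∉ tsupport χ := fun h => hy (hsupp h)
    have hev : (fun y => χ y • G y) =ᶠ[𝓝 y] fun _ => 0 := by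
      filter_upwards [(notMem_tsupport_iff_eventuallyEq.1 hy')] with w hw
      rw [hw, Pi.zero_apply, zero_smul]
    exact contDiffAt_const.congr_of_eventuallyEq hev

end SmoothCutoff

/-! ### The test field `A_{x,a}(y) = χ_{R'}(y) K(y − x) a` for a far point `x` -/

section TestField

variable {R' : ℝ} {x a : (EuclideanSpace ℝ (Fin 3))}

/-- The topological support of the cut-off `χ_{R'}` lies in the closed ball of radius `2R'`. [folklore] -/
private theorem tsupport_cutoff_subset_closedBall (hR' : 0 < R') :
    tsupport (cutoff (E := (EuclideanSpace ℝ (Fin 3))) R') ⊆ closedBall (0 : (EuclideanSpace ℝ (Fin 3))) (2 * R') := by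
  refine closure_minimal (fun y hy => ?_) isClosed_closedBall
  rw [mem_closedBall_zero_iff]
  by_contra h
  exact hy (cutoff_eq_zero hR' (not_le.1 h).le)

/-- On the ball of radius `3R'` the translated kernel `y ↦ K(y − x) a` is smooth when
`4R' ≤ ‖x‖` (the singularity `y = x` is outside). [folklore] -/
theorem contDiffOn_biotSavartKernel_sub_far (hR' : 0 < R') (hx : 4 * R' ≤ ‖x‖) {n : WithTop ℕ∞} :
    ContDiffOn ℝ n (fun y : (EuclideanSpace ℝ (Fin 3)) => biotSavartKernel (y - x) a) (ball (0 : (EuclideanSpace ℝ (Fin 3))) (3 * R')) := by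
  intro y hy
  rw [mem_ball_zero_iff] at hy
  have hyx : y - x ≠ 0 := by
    intro h
    rw [sub_eq_zero] at h
    rw [h] at hy
    linarith
  exact ((contDiffAt_biotSavartKernel_left hyx a).comp y
    (contDiffAt_id.sub contDiffAt_const)).contDiffWithinAt

/-- **The test field is smooth** (the cut-off kills the singularity of the kernel). [folklore] -/
theorem contDiff_cutoff_smul_biotSavartKernel_sub (hR' : 0 < R') (hx : 4 * R' ≤ ‖x‖) {n : ℕ∞} :
    ContDiff ℝ n fun y : (EuclideanSpace ℝ (Fin 3)) => cutoff R' y • biotSavartKernel (y - x) a := by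
  refine contDiff_smul_of_tsupport_subset isOpen_ball (contDiff_cutoff (n := n) R') ?_
    (contDiffOn_biotSavartKernel_sub_far hR' hx)
  exact (tsupport_cutoff_subset_closedBall hR').trans (closedBall_subset_ball (by linarith))

/-- The test field vanishes off the ball of radius `2R'`. [folklore] -/
theorem cutoff_smul_biotSavartKernel_sub_eq_zero (hR' : 0 < R') {y : (EuclideanSpace ℝ (Fin 3))} (hy : 2 * R' ≤ ‖y‖) :
    cutoff R' y • biotSavartKernel (y - x) a = 0 := by
  rw [cutoff_eq_zero hR' hy, zero_smul]

/-- The test field has compact support (in the closed ball of radius `2R'`). [folklore] -/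
theorem hasCompactSupport_cutoff_smul_biotSavartKernel_sub (hR' : 0 < R') :
    HasCompactSupport fun y : (EuclideanSpace ℝ (Fin 3)) => cutoff R' y • biotSavartKernel (y - x) a := by
  refine HasCompactSupport.intro (isCompact_closedBall (0 : (EuclideanSpace ℝ (Fin 3))) (2 * R')) fun y hy => ?_
  rw [mem_closedBall_zero_iff, not_le] at hy
  exact cutoff_smul_biotSavartKernel_sub_eq_zero hR' hy.le

/-- On the ball of radius `R'` the test field is the translated kernel itself. [folklore] -/
theorem cutoff_smul_biotSavartKernel_sub_eq (hR' : 0 < R') {y : (EuclideanSpace ℝ (Fin 3))} (hy : ‖y‖ ≤ R') :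
    cutoff R' y • biotSavartKernel (y - x) a = biotSavartKernel (y - x) a := by
  rw [cutoff_eq_one hR' hy, one_smul]

/-- Off the closed ball of radius `2R'` the test field vanishes near every point, so its curl
vanishes there. [folklore] -/
theorem curl_cutoff_smul_biotSavartKernel_sub_eq_zero (hR' : 0 < R') {y : (EuclideanSpace ℝ (Fin 3))} (hy : 2 * R' < ‖y‖) :
    curl (fun y : (EuclideanSpace ℝ (Fin 3)) => cutoff R' y • biotSavartKernel (y - x) a) y = 0 := by
  have hev : (fun y : (EuclideanSpace ℝ (Fin 3)) => cutoff R' y • biotSavartKernel (y - x) a) =ᶠ[𝓝 y] fun _ => 0 := by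
    filter_upwards [(isOpen_lt continuous_const continuous_norm).mem_nhds hy] with w hw
    exact cutoff_smul_biotSavartKernel_sub_eq_zero hR' hw.le
  exact curl_eq_zero_of_fderiv_eq_zero (by rw [hev.fderiv_eq, fderiv_const_apply])

/-- **Decay in `x` of the curl of the test field**: there is `B = B(a)` such that for every
`R' ≥ 1` and every `x` with `4R' ≤ ‖x‖`, `‖curl A_{x,a}(y)‖ ≤ B ‖x‖⁻²` for all `y` (on the
support, `‖y − x‖ ≥ ‖x‖/2`, and `|DK| ≲ |z|⁻³`, `|K| ≲ |z|⁻²`, `|∇χ_{R'}| ≲ 1/R' ≤ 1`). [folklore] -/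
theorem exists_norm_curl_cutoff_smul_biotSavartKernel_sub_le (a : (EuclideanSpace ℝ (Fin 3))) :
    ∃ B : ℝ, 0 ≤ B ∧ ∀ R' : ℝ, 1 ≤ R' → ∀ x : (EuclideanSpace ℝ (Fin 3)), 4 * R' ≤ ‖x‖ → ∀ y : (EuclideanSpace ℝ (Fin 3)),
      ‖curl (fun y : (EuclideanSpace ℝ (Fin 3)) => cutoff R' y • biotSavartKernel (y - x) a) y‖ ≤ B * (‖x‖ ^ 2)⁻¹ := by
  obtain ⟨M, hM0, hM⟩ := exists_norm_fderiv_biotSavartKernel_le a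
  obtain ⟨Cχ, hCχ0, hCχ⟩ := exists_norm_fderiv_cutoff_le (E := (EuclideanSpace ℝ (Fin 3)))
  refine ⟨‖curlCLM‖ * (8 * M + Cχ * (Real.pi⁻¹ * ‖a‖)), by positivity, fun R' hR' x hx y => ?_⟩
  have hR'0 : 0 < R' := one_pos.trans_le hR'
  have hx1 : 1 ≤ ‖x‖ := by linarith
  have hx0 : 0 < ‖x‖ := one_pos.trans_le hx1
  set A : (EuclideanSpace ℝ (Fin 3)) → (EuclideanSpace ℝ (Fin 3)) := fun y => cutoff R' y • biotSavartKernel (y - x) a with hA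
  by_cases hy : 2 * R' < ‖y‖
  · -- off the support the field vanishes near `y`
    rw [hA, curl_cutoff_smul_biotSavartKernel_sub_eq_zero hR'0 hy, norm_zero]
    positivity
  rw [not_lt] at hy
  -- on the support: `z = y - x` is far from the singularity
  set z : (EuclideanSpace ℝ (Fin 3)) := y - x with hz
  have hz1 : ‖x‖ / 2 ≤ ‖z‖ := by
    have : ‖x‖ ≤ ‖y - x‖ + ‖y‖ := by
      calc ‖x‖ = ‖y - (y - x)‖ := by rw [sub_sub_cancel]
        _ ≤ ‖y‖ + ‖y - x‖ := norm_sub_le _ _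
        _ = ‖y - x‖ + ‖y‖ := add_comm _ _
    rw [hz]; linarith
  have hz2 : 1 ≤ ‖z‖ := by linarith
  have hz0 : z ≠ 0 := by
    intro h; rw [h, norm_zero] at hz2; linarith
  set G : (EuclideanSpace ℝ (Fin 3)) → (EuclideanSpace ℝ (Fin 3)) := fun y => biotSavartKernel (y - x) a with hG
  have hGd : DifferentiableAt ℝ G y :=
    (differentiableAt_comp_sub x).2 ((contDiffAt_biotSavartKernel_left hz0 a (n := 1)).differentiableAt one_ne_zero)
  have hχd : DifferentiableAt ℝ (cutoff (E := (EuclideanSpace ℝ (Fin 3))) R') y :=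
    ((contDiff_cutoff (n := 1) R').differentiable one_ne_zero) y
  have hcurl : curl A y = cutoff R' y • curl G y + curlCLM ((fderiv ℝ (cutoff R') y).smulRight (G y)) :=
    curl_smul hχd hGd
  -- the two size estimates
  have hDG : ‖fderiv ℝ G y‖ ≤ 8 * M * (‖x‖ ^ 2)⁻¹ := by
    rw [hG, fderiv_comp_sub (f := fun w => biotSavartKernel w a) x]
    refine (hM z hz2).trans ?_
    have h1 : (‖z‖ ^ 3)⁻¹ ≤ 8 * (‖x‖ ^ 3)⁻¹ := by
      have h2 : (‖x‖ / 2) ^ 3 ≤ ‖z‖ ^ 3 := pow_le_pow_left₀ (by positivity) hz1 3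
      have h3 : (‖z‖ ^ 3)⁻¹ ≤ ((‖x‖ / 2) ^ 3)⁻¹ := inv_anti₀ (by positivity) h2
      refine h3.trans (le_of_eq ?_)
      field_simp
      ring
    have h4 : (‖x‖ ^ 3)⁻¹ ≤ (‖x‖ ^ 2)⁻¹ :=
      inv_anti₀ (by positivity) (pow_le_pow_right₀ hx1 (by norm_num))
    calc M * (‖z‖ ^ 3)⁻¹ ≤ M * (8 * (‖x‖ ^ 3)⁻¹) := mul_le_mul_of_nonneg_left h1 hM0
      _ ≤ M * (8 * (‖x‖ ^ 2)⁻¹) := by gcongr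
      _ = 8 * M * (‖x‖ ^ 2)⁻¹ := by ring
  have hGy : ‖G y‖ ≤ Real.pi⁻¹ * ‖a‖ * (‖x‖ ^ 2)⁻¹ := by
    have h1 := norm_biotSavartKernel_le z a
    have h2 : (‖z‖ ^ 2)⁻¹ ≤ 4 * (‖x‖ ^ 2)⁻¹ := by
      have h3 : (‖x‖ / 2) ^ 2 ≤ ‖z‖ ^ 2 := pow_le_pow_left₀ (by positivity) hz1 2
      have h4 : (‖z‖ ^ 2)⁻¹ ≤ ((‖x‖ / 2) ^ 2)⁻¹ := inv_anti₀ (by positivity) h3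
      refine h4.trans (le_of_eq ?_)
      field_simp
      norm_num
    calc ‖G y‖ = ‖biotSavartKernel z a‖ := rfl
      _ ≤ (4 * Real.pi)⁻¹ * ‖a‖ * (‖z‖ ^ 2)⁻¹ := h1
      _ ≤ (4 * Real.pi)⁻¹ * ‖a‖ * (4 * (‖x‖ ^ 2)⁻¹) := by gcongr
      _ = Real.pi⁻¹ * ‖a‖ * (‖x‖ ^ 2)⁻¹ := by field_simp
  have hχy : ‖fderiv ℝ (cutoff (E := (EuclideanSpace ℝ (Fin 3))) R') y‖ ≤ Cχ :=
    (hCχ R' hR'0 y).trans (div_le_self hCχ0 hR')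
  -- combine
  rw [hcurl]
  calc ‖cutoff R' y • curl G y + curlCLM ((fderiv ℝ (cutoff R') y).smulRight (G y))‖
      ≤ ‖cutoff R' y • curl G y‖ + ‖curlCLM ((fderiv ℝ (cutoff R') y).smulRight (G y))‖ :=
        norm_add_le _ _
    _ ≤ 1 * (‖curlCLM‖ * ‖fderiv ℝ G y‖) + ‖curlCLM‖ * (‖fderiv ℝ (cutoff (E := (EuclideanSpace ℝ (Fin 3))) R') y‖ * ‖G y‖) := by
        refine add_le_add ?_ (norm_curlCLM_smulRight_le _ _)
        rw [norm_smul]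
        exact mul_le_mul (by rw [Real.norm_eq_abs]; exact abs_cutoff_le_one R' y) (norm_curl_le G y)
          (norm_nonneg _) zero_le_one
    _ ≤ 1 * (‖curlCLM‖ * (8 * M * (‖x‖ ^ 2)⁻¹)) +
          ‖curlCLM‖ * (Cχ * (Real.pi⁻¹ * ‖a‖ * (‖x‖ ^ 2)⁻¹)) := by
        have hc0 : 0 ≤ ‖curlCLM‖ := ContinuousLinearMap.opNorm_nonneg curlCLM
        exact add_le_add
          (mul_le_mul_of_nonneg_left (mul_le_mul_of_nonneg_left hDG hc0) zero_le_one)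
          (mul_le_mul_of_nonneg_left (mul_le_mul hχy hGy (norm_nonneg _) hCχ0) hc0)
    _ = ‖curlCLM‖ * (8 * M + Cχ * (Real.pi⁻¹ * ‖a‖)) * (‖x‖ ^ 2)⁻¹ := by ring

end TestField

/-! ### The far field of a Biot–Savart velocity as an integral against the curl of the test
field, and its time derivative -/

section Representation

variable {R' : ℝ} {x a : (EuclideanSpace ℝ (Fin 3))}

/-- **Pointwise values of a Biot–Savart velocity far from the vorticity, tested against the
velocity itself.** If `v ∈ C¹` is the Biot–Savart velocity of its own curl, `v = K₃ ∗ curl v`,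
and `curl v` is supported in the closed ball of radius `R' ≥ 1`, then for `4R' ≤ ‖x‖` and any
vector `a`, `⟪a, v(x)⟫ = ∫ ⟪v(y), curl A_{x,a}(y)⟫ dy` with the smooth compactly supported test
field `A_{x,a}(y) = χ_{R'}(y) K(y − x) a`: indeed `⟪a, K(x − y) ω(y)⟫ = ⟪ω(y), K(y − x) a⟫`
(`inner_biotSavartKernel_left`), `A_{x,a} = K(· − x) a` on the support of `ω = curl v`, and the
curl is moved onto the test field (`integral_inner_curl_eq_integral_inner_curl`). [folklore] -/
theorem inner_eq_integral_inner_curl_testField {v : (EuclideanSpace ℝ (Fin 3)) → (EuclideanSpace ℝ (Fin 3))} (hv : ContDiff ℝ 1 v)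
    (hR' : 1 ≤ R') (hsupp : support (curl v) ⊆ closedBall (0 : (EuclideanSpace ℝ (Fin 3))) R')
    (hrep : biotSavart (curl v) = v) (hx : 4 * R' ≤ ‖x‖) (a : (EuclideanSpace ℝ (Fin 3))) :
    ⟪a, v x⟫ = ∫ y, ⟪v y, curl (fun y : (EuclideanSpace ℝ (Fin 3)) => cutoff R' y • biotSavartKernel (y - x) a) y⟫ := by
  have hR'0 : 0 < R' := one_pos.trans_le hR'
  set ω : (EuclideanSpace ℝ (Fin 3)) → (EuclideanSpace ℝ (Fin 3)) := curl v with hω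
  set A : (EuclideanSpace ℝ (Fin 3)) → (EuclideanSpace ℝ (Fin 3)) := fun y => cutoff R' y • biotSavartKernel (y - x) a with hA
  have hωc : Continuous ω := continuous_curl hv
  have hωcs : HasCompactSupport ω :=
    HasCompactSupport.intro (isCompact_closedBall (0 : (EuclideanSpace ℝ (Fin 3))) R') fun y hy =>
      notMem_support.1 fun h => hy (hsupp h)
  have hωi : Integrable ω := hωc.integrable_of_hasCompactSupport hωcs
  obtain ⟨C, hC⟩ := hωc.bounded_above_of_compact_support hωcs
  have hA1 : ContDiff ℝ 1 A := contDiff_cutoff_smul_biotSavartKernel_sub hR'0 hx (n := 1)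
  have hAc : HasCompactSupport A := hasCompactSupport_cutoff_smul_biotSavartKernel_sub hR'0
  -- `v x = ∫ K(x - y) ω(y) dy`
  have h1 : v x = ∫ y, biotSavartKernel (x - y) (ω y) := by
    rw [← congrFun hrep x]; rfl
  -- pointwise identity of the integrands
  have hpt : ∀ y, ⟪a, biotSavartKernel (x - y) (ω y)⟫ = ⟪ω y, A y⟫ := by
    intro y
    by_cases hωy : ω y = 0
    · rw [hωy, biotSavartKernel_zero_right, inner_zero_right, inner_zero_left]
    · have hy : ‖y‖ ≤ R' := mem_closedBall_zero_iff.1 (hsupp (mem_support.2 hωy))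
      rw [hA]
      dsimp only
      rw [cutoff_smul_biotSavartKernel_sub_eq hR'0 hy, real_inner_comm,
        inner_biotSavartKernel_left, neg_sub]
  calc ⟪a, v x⟫ = ⟪a, ∫ y, biotSavartKernel (x - y) (ω y)⟫ := by rw [h1]
    _ = ∫ y, ⟪a, biotSavartKernel (x - y) (ω y)⟫ :=
        (integral_inner (integrable_biotSavartKernel_sub_apply hωc.measurable hωi hC x) a).symm
    _ = ∫ y, ⟪ω y, A y⟫ := integral_congr_ae (Eventually.of_forall hpt)
    _ = ∫ y, ⟪v y, curl A y⟫ := integral_inner_curl_eq_integral_inner_curl hv hA1 hAc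

/-- **Differentiation in time of `∫ ⟪u(r, y), B(y)⟫ dy`** for a jointly `C¹` field `u` on
`S × ℝ³` and a `C¹` compactly supported `B`: at every interior time `s` of `S`, the derivative is
`∫ ⟪∂ₜu(s, y), B(y)⟫ dy` (differentiation under the integral sign on the compact support of `B`,
`hasDerivAt_integral_of_contDiffOn`). [folklore] -/
theorem hasDerivAt_integral_inner_of_contDiffOn {u : ℝ → (EuclideanSpace ℝ (Fin 3)) → (EuclideanSpace ℝ (Fin 3))} {S : Set ℝ}
    (hsm : ContDiffOn ℝ 1 (uncurry u) (S ×ˢ univ)) (hS : UniqueDiffOn ℝ S) {B : (EuclideanSpace ℝ (Fin 3)) → (EuclideanSpace ℝ (Fin 3))}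
    (hB : ContDiff ℝ 1 B) (hBc : HasCompactSupport B) {s : ℝ} (hs : S ∈ 𝓝 s) :
    HasDerivAt (fun r => ∫ y, ⟪u r y, B y⟫) (∫ y, ⟪timeDerivWithin S u s y, B y⟫) s := by
  have hsi : s ∈ interior S := mem_interior_iff_mem_nhds.2 hs
  have hsS : s ∈ S := interior_subset hsi
  set Φ : ℝ → (EuclideanSpace ℝ (Fin 3)) → ℝ := fun r y => ⟪u r y, B y⟫ with hΦ
  have hΦO : ContDiffOn ℝ 1 (uncurry Φ) (interior S ×ˢ univ) := by
    have h1 : ContDiffOn ℝ 1 (uncurry u) (interior S ×ˢ univ) :=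
      hsm.mono (prod_mono interior_subset Subset.rfl)
    have h2 : ContDiffOn ℝ 1 (fun z : ℝ × (EuclideanSpace ℝ (Fin 3)) => B z.2) (interior S ×ˢ univ) :=
      (hB.comp contDiff_snd).contDiffOn
    exact h1.inner ℝ h2
  have hsupp : ∀ r ∈ interior S, ∀ y ∉ tsupport B, Φ r y = 0 := fun r _ y hy => by
    simp only [hΦ, image_eq_zero_of_notMem_tsupport hy, inner_zero_right]
  have hd := hasDerivAt_integral_of_contDiffOn (μ := (volume : Measure (EuclideanSpace ℝ (Fin 3)))) isOpen_interior hΦO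
    hBc hsupp hsi
  have hline : ∀ y, HasDerivAt (fun r => Φ r y) ⟪timeDerivWithin S u s y, B y⟫ s := by
    intro y
    have h1 : HasDerivAt (fun r => u r y) (timeDerivWithin S u s y) s :=
      (hasDerivWithinAt_timeLine_of_contDiffOn hsm hS hsS y).hasDerivAt hs
    have h2 := h1.inner ℝ (hasDerivAt_const s (B y))
    simpa using h2
  have heq : (fun y => deriv (fun r => Φ r y) s) = fun y => ⟪timeDerivWithin S u s y, B y⟫ :=
    funext fun y => (hline y).deriv
  rw [heq] at hd
  exact hd

end Representation

/-! ### Decay of the time derivative of a classical Euler solution whose slices are Biot–Savart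
velocities of compactly supported vorticities -/

section TimeDeriv

/-- `‖v‖ ≤ |v₀| + |v₁| + |v₂|` on `ℝ³` (the Euclidean norm is dominated by the `ℓ¹` norm). [folklore] -/
theorem norm_le_abs_add_abs_add_abs (v : (EuclideanSpace ℝ (Fin 3))) : ‖v‖ ≤ |v 0| + |v 1| + |v 2| := by
  have hv : v = ∑ i, v i • EuclideanSpace.single i (1 : ℝ) := by
    simpa using ((EuclideanSpace.basisFun (Fin 3) ℝ).sum_repr v).symm
  have h1 : ‖v‖ ≤ ∑ i, ‖v i • EuclideanSpace.single i (1 : ℝ)‖ := by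
    conv_lhs => rw [hv]
    exact norm_sum_le _ _
  refine h1.trans (le_of_eq ?_)
  simp only [norm_smul, EuclideanSpace.single, PiLp.norm_single, norm_one, mul_one,
    Real.norm_eq_abs, Fin.sum_univ_three]

/-- **Decay of `∂ₜu` for classical Euler solutions whose slices are Biot–Savart velocities of
compactly supported vorticities** (the hypothesis "`v` vanishes sufficiently rapidly as
`|x| ↗ ∞`" of Majda–Bertozzi §3.1.1, p. 87, for the time derivative, in the `C^{1,γ}` setting of
their §4.1: by (4.4)/(2.114) the velocity is `v(·,t) = ∫ K₃(x − x') ω(x', t) dx'` with `ω(·,t)`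
supported in a bounded set). Let `(u, p)` be a classical solution of the Euler equations with
zero force on `ℝ³ × [0, T)` (`C¹` jointly), and suppose that on `[0, T₁]`, `T₁ < T`, every slice
is the Biot–Savart velocity of its curl, the curls are supported in a fixed ball `B̄(0, R)`, and
`|u|, |∇u| ≤ U`. Then `|∂ₜu(s, x)| ≤ C (1 + |x|)⁻²` on `[0, T₁] × ℝ³`. Proof: near the origin
(`|x| ≤ 4R'`, `R' = max(R, 1)`) by continuity of `∂ₜu` on the compact `[0, T₁] × B̄(0, 4R')`;
far away, `⟪a, u(r, x)⟫ = ∫ ⟪u(r, y), curl A_{x,a}(y)⟫ dy` for `r` near `s`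
(`inner_eq_integral_inner_curl_testField`), so differentiating in time
(`hasDerivAt_integral_inner_of_contDiffOn`) and inserting the momentum equation,
`⟪a, ∂ₜu(s, x)⟫ = −∫ ⟪∇p, curl A⟫ − ∫ ⟪(u·∇)u, curl A⟫ = −∫ ⟪(u·∇)u, curl A⟫` (the pressure
term vanishes since `div curl A = 0`, `A ∈ C_c²`), which is `≤ U² ∫ |curl A_{x,a}| ≲ |x|⁻²`
(`exists_norm_curl_cutoff_smul_biotSavartKernel_sub_le`); the endpoints `s = 0, T₁` follow by
continuity in time. [cite: MajdaBertozziCUP2002, §3.1.1 p. 87 (decay hypothesis) with §4.1 eq. (4.4) (p. 124) and Lemma 4.5 (p. 129)] -/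
theorem IsClassicalEulerOnDomain.exists_norm_timeDerivWithin_le {T T₁ : ℝ} (hT₁ : T₁ < T)
    (hT₁0 : 0 < T₁) {nrm : (EuclideanSpace ℝ (Fin 3)) → (EuclideanSpace ℝ (Fin 3))} {u : ℝ → (EuclideanSpace ℝ (Fin 3)) → (EuclideanSpace ℝ (Fin 3))} {p : ℝ → (EuclideanSpace ℝ (Fin 3)) → ℝ}
    (h : IsClassicalEulerOnDomain (Ico 0 T) (⊤ : TopologicalSpace.Opens (EuclideanSpace ℝ (Fin 3))) nrm 0 u p)
    {R U : ℝ} (hrep : ∀ s ∈ Icc 0 T₁, biotSavart (curl (u s)) = u s)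
    (hsupp : ∀ s ∈ Icc 0 T₁, support (curl (u s)) ⊆ closedBall (0 : (EuclideanSpace ℝ (Fin 3))) R)
    (hU : ∀ s ∈ Icc 0 T₁, ∀ x, ‖u s x‖ ≤ U ∧ ‖fderiv ℝ (u s) x‖ ≤ U) :
    ∃ C : ℝ, ∀ s ∈ Icc 0 T₁, ∀ x,
      ‖timeDerivWithin (Ico 0 T) u s x‖ ≤ C * ((1 + ‖x‖) ^ 2)⁻¹ := by
  set S : Set ℝ := Ico 0 T with hS_def
  have hS : UniqueDiffOn ℝ S := uniqueDiffOn_Ico 0 T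
  have hIS : Icc 0 T₁ ⊆ S := Icc_subset_Ico_right hT₁
  have h0I : (0 : ℝ) ∈ Icc 0 T₁ := ⟨le_rfl, hT₁0.le⟩
  have hcl : closure ((⊤ : TopologicalSpace.Opens (EuclideanSpace ℝ (Fin 3))) : Set (EuclideanSpace ℝ (Fin 3))) = univ := by
    rw [TopologicalSpace.Opens.coe_top, closure_univ]
  have hsm : ContDiffOn ℝ 1 (uncurry u) (S ×ˢ univ) := by
    have h' := h.smooth.1; rwa [hcl] at h'
  have hsp : ContDiffOn ℝ 1 (uncurry p) (S ×ˢ univ) := by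
    have h' := h.smooth.2; rwa [hcl] at h'
  have hU0 : 0 ≤ U := (norm_nonneg _).trans (hU 0 h0I 0).1
  set R' : ℝ := max R 1 with hR'
  have hR'1 : 1 ≤ R' := le_max_right _ _
  have hR'0 : 0 < R' := one_pos.trans_le hR'1
  have hRR' : R ≤ R' := le_max_left _ _
  have hsupp' : ∀ s ∈ Icc 0 T₁, support (curl (u s)) ⊆ closedBall (0 : (EuclideanSpace ℝ (Fin 3))) R' := fun s hs =>
    (hsupp s hs).trans (closedBall_subset_closedBall hRR')
  -- the momentum equation `∂ₜu = -∇p - (u·∇)u`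
  have hmom : ∀ s ∈ S, ∀ y, timeDerivWithin S u s y =
      -gradient (p s) y - fderiv ℝ (u s) y (u s y) := by
    intro s hs y
    have h' := h.momentum s hs y (TopologicalSpace.Opens.mem_top y)
    simp only [convect_apply, Pi.zero_apply, add_zero] at h'
    rw [← h']; abel
  -- continuity of `∂ₜu` on `S × ℝ³`
  have hdtc : ContinuousOn (fun z : ℝ × (EuclideanSpace ℝ (Fin 3)) => timeDerivWithin S u z.1 z.2) (S ×ˢ univ) :=
    continuousOn_timeDerivWithin_of_contDiffOn hsm hS
  -- (1) near field: a bound on the compact `[0, T₁] × B̄(0, 4R')`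
  obtain ⟨B₀, hB₀⟩ : ∃ B₀, ∀ z ∈ Icc 0 T₁ ×ˢ closedBall (0 : (EuclideanSpace ℝ (Fin 3))) (4 * R'),
      ‖timeDerivWithin S u z.1 z.2‖ ≤ B₀ :=
    (isCompact_Icc.prod (isCompact_closedBall _ _)).exists_bound_of_continuousOn
      (hdtc.mono (prod_mono hIS (subset_univ _)))
  have hB₀0 : 0 ≤ B₀ :=
    (norm_nonneg _).trans (hB₀ ((0 : ℝ), (0 : (EuclideanSpace ℝ (Fin 3)))) ⟨h0I, mem_closedBall_self (by positivity)⟩)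
  -- (2) far field, tested against a fixed vector `a`
  have far : ∀ a : (EuclideanSpace ℝ (Fin 3)), ∃ Ca : ℝ, 0 ≤ Ca ∧ ∀ s ∈ Ioo 0 T₁, ∀ x : (EuclideanSpace ℝ (Fin 3)), 4 * R' ≤ ‖x‖ →
      |⟪a, timeDerivWithin S u s x⟫| ≤ Ca * (‖x‖ ^ 2)⁻¹ := by
    intro a
    obtain ⟨B, hB0, hB⟩ := exists_norm_curl_cutoff_smul_biotSavartKernel_sub_le a
    set V : ℝ := (volume (closedBall (0 : (EuclideanSpace ℝ (Fin 3))) (2 * R'))).toReal with hV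
    have hV0 : 0 ≤ V := ENNReal.toReal_nonneg
    refine ⟨U * U * (B * V), by positivity, fun s hs x hx => ?_⟩
    have hsI : s ∈ Icc 0 T₁ := Ioo_subset_Icc_self hs
    have hsS : s ∈ S := hIS hsI
    have hSs : S ∈ 𝓝 s :=
      mem_of_superset (Ioo_mem_nhds hs.1 (hs.2.trans hT₁)) Ioo_subset_Ico_self
    set A : (EuclideanSpace ℝ (Fin 3)) → (EuclideanSpace ℝ (Fin 3)) := fun y => cutoff R' y • biotSavartKernel (y - x) a with hA
    have hA2 : ContDiff ℝ 2 A := contDiff_cutoff_smul_biotSavartKernel_sub hR'0 hx (n := 2)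
    have hAc : HasCompactSupport A := hasCompactSupport_cutoff_smul_biotSavartKernel_sub hR'0
    set Bf : (EuclideanSpace ℝ (Fin 3)) → (EuclideanSpace ℝ (Fin 3)) := curl A with hBf
    have hBf1 : ContDiff ℝ 1 Bf := contDiff_curl (n := 1) (by exact_mod_cast hA2)
    have hBfc : HasCompactSupport Bf := hasCompactSupport_curl hAc
    have hBfcont : Continuous Bf := hBf1.continuous
    -- the two functions of time agree near `s`
    have hident : ∀ r ∈ Icc 0 T₁, ⟪a, u r x⟫ = ∫ y, ⟪u r y, Bf y⟫ := fun r hr =>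
      inner_eq_integral_inner_curl_testField (contDiff_slice_of_contDiffOn hsm (hIS hr)) hR'1
        (hsupp' r hr) (hrep r hr) hx a
    have hφ : HasDerivAt (fun r => ⟪a, u r x⟫) ⟪a, timeDerivWithin S u s x⟫ s := by
      have h1 : HasDerivAt (fun r => u r x) (timeDerivWithin S u s x) s :=
        (hasDerivWithinAt_timeLine_of_contDiffOn hsm hS hsS x).hasDerivAt hSs
      simpa using (hasDerivAt_const s a).inner ℝ h1
    have hΨ : HasDerivAt (fun r => ∫ y, ⟪u r y, Bf y⟫)
        (∫ y, ⟪timeDerivWithin S u s y, Bf y⟫) s :=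
      hasDerivAt_integral_inner_of_contDiffOn hsm hS hBf1 hBfc hSs
    have hev : (fun r => ⟪a, u r x⟫) =ᶠ[𝓝 s] fun r => ∫ y, ⟪u r y, Bf y⟫ := by
      filter_upwards [Ioo_mem_nhds hs.1 hs.2] with r hr using hident r (Ioo_subset_Icc_self hr)
    have hderiv_eq : ⟪a, timeDerivWithin S u s x⟫ = ∫ y, ⟪timeDerivWithin S u s y, Bf y⟫ :=
      hφ.unique (hΨ.congr_of_eventuallyEq hev)
    -- insert the momentum equation; the pressure term drops out since `div curl A = 0`
    have hps : ContDiff ℝ 1 (p s) := contDiff_slice_of_contDiffOn hsp hsS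
    have hus : ContDiff ℝ 1 (u s) := contDiff_slice_of_contDiffOn hsm hsS
    have hdivBf : ∀ y, VectorCalculus.divergence Bf y = 0 := fun y =>
      divergence_curl_eq_zero_holds A hA2 y
    have hgradc : Continuous (gradient (p s)) := continuous_gradient_of_contDiff hps
    have hconvc : Continuous fun y => fderiv ℝ (u s) y (u s y) :=
      (hus.continuous_fderiv one_ne_zero).clm_apply hus.continuous
    have hI1 : Integrable fun y => ⟪gradient (p s) y, Bf y⟫ :=
      (hgradc.inner hBfcont).integrable_of_hasCompactSupport
        (hBfc.mono fun y hy h0 => hy (by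
          show ⟪gradient (p s) y, Bf y⟫ = 0
          rw [h0, inner_zero_right]))
    have hI2 : Integrable fun y => ⟪fderiv ℝ (u s) y (u s y), Bf y⟫ :=
      (hconvc.inner hBfcont).integrable_of_hasCompactSupport
        (hBfc.mono fun y hy h0 => hy (by
          show ⟪fderiv ℝ (u s) y (u s y), Bf y⟫ = 0
          rw [h0, inner_zero_right]))
    have hpress : ∫ y, ⟪gradient (p s) y, Bf y⟫ = 0 := by
      rw [integral_inner_gradient_eq_neg_integral_mul_divergence hps hBf1 hBfc]
      simp [hdivBf]
    have hsplit : ∫ y, ⟪timeDerivWithin S u s y, Bf y⟫ =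
        -∫ y, ⟪fderiv ℝ (u s) y (u s y), Bf y⟫ := by
      have e : ∀ y, ⟪timeDerivWithin S u s y, Bf y⟫ =
          -⟪gradient (p s) y, Bf y⟫ - ⟪fderiv ℝ (u s) y (u s y), Bf y⟫ := fun y => by
        rw [hmom s hsS y, inner_sub_left, inner_neg_left]
      simp_rw [e]
      have hI1n : Integrable fun y => -⟪gradient (p s) y, Bf y⟫ := hI1.neg
      rw [integral_sub hI1n hI2, integral_neg, hpress, neg_zero, zero_sub]
    -- the bound `U² ∫ |curl A| ≤ U² B V / |x|²`
    have hzero : ∀ y, y ∉ closedBall (0 : (EuclideanSpace ℝ (Fin 3))) (2 * R') →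
        ⟪fderiv ℝ (u s) y (u s y), Bf y⟫ = 0 := fun y hy => by
      rw [mem_closedBall_zero_iff, not_le] at hy
      rw [hBf, hA, curl_cutoff_smul_biotSavartKernel_sub_eq_zero hR'0 hy, inner_zero_right]
    have hpt : ∀ y ∈ closedBall (0 : (EuclideanSpace ℝ (Fin 3))) (2 * R'),
        ‖⟪fderiv ℝ (u s) y (u s y), Bf y⟫‖ ≤ U * U * (B * (‖x‖ ^ 2)⁻¹) := by
      intro y _
      refine (norm_inner_le_norm _ _).trans ?_
      refine mul_le_mul ?_ (hB R' hR'1 x hx y) (norm_nonneg _) (by positivity)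
      calc ‖fderiv ℝ (u s) y (u s y)‖ ≤ ‖fderiv ℝ (u s) y‖ * ‖u s y‖ :=
            ContinuousLinearMap.le_opNorm _ _
        _ ≤ U * U := mul_le_mul (hU s hsI y).2 (hU s hsI y).1 (norm_nonneg _) hU0
    have hbound : ‖∫ y, ⟪fderiv ℝ (u s) y (u s y), Bf y⟫‖ ≤ U * U * (B * (‖x‖ ^ 2)⁻¹) * V := by
      rw [← setIntegral_eq_integral_of_forall_compl_eq_zero hzero]
      have h' := norm_setIntegral_le_of_norm_le_const (μ := (volume : Measure (EuclideanSpace ℝ (Fin 3))))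
        measure_closedBall_lt_top hpt
      rwa [Measure.real, ← hV] at h'
    calc |⟪a, timeDerivWithin S u s x⟫| = ‖∫ y, ⟪fderiv ℝ (u s) y (u s y), Bf y⟫‖ := by
          rw [hderiv_eq, hsplit, ← Real.norm_eq_abs, norm_neg]
      _ ≤ U * U * (B * (‖x‖ ^ 2)⁻¹) * V := hbound
      _ = U * U * (B * V) * (‖x‖ ^ 2)⁻¹ := by ring
  -- (3) combine near and far fields at interior times
  obtain ⟨C0, hC00, hC0⟩ := far (EuclideanSpace.single 0 1)
  obtain ⟨C1, hC10, hC1⟩ := far (EuclideanSpace.single 1 1)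
  obtain ⟨C2, hC20, hC2⟩ := far (EuclideanSpace.single 2 1)
  set Cfin : ℝ := B₀ * (1 + 4 * R') ^ 2 + 4 * (C0 + C1 + C2) with hCfin
  have hIoo : ∀ s ∈ Ioo 0 T₁, ∀ x, ‖timeDerivWithin S u s x‖ ≤ Cfin * ((1 + ‖x‖) ^ 2)⁻¹ := by
    intro s hs x
    have hw0 : 0 < ((1 + ‖x‖) ^ 2)⁻¹ := by positivity
    rcases le_or_gt (4 * R') ‖x‖ with hfar | hnear
    · -- far field
      have hx1 : 1 ≤ ‖x‖ := by linarith
      set v : (EuclideanSpace ℝ (Fin 3)) := timeDerivWithin S u s x with hv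
      have hi : ∀ i : Fin 3, |v i| = |⟪EuclideanSpace.single i (1 : ℝ), v⟫| := fun i => by
        rw [EuclideanSpace.inner_single_left]; simp
      have hsum : ‖v‖ ≤ (C0 + C1 + C2) * (‖x‖ ^ 2)⁻¹ := by
        refine (norm_le_abs_add_abs_add_abs v).trans ?_
        rw [hi 0, hi 1, hi 2, add_mul, add_mul]
        exact add_le_add_three (hC0 s hs x hfar) (hC1 s hs x hfar) (hC2 s hs x hfar)
      have hcmp : (‖x‖ ^ 2)⁻¹ ≤ 4 * ((1 + ‖x‖) ^ 2)⁻¹ := by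
        rw [← div_eq_mul_inv, le_div_iff₀ (by positivity), ← div_eq_inv_mul,
          div_le_iff₀ (by positivity)]
        nlinarith
      calc ‖v‖ ≤ (C0 + C1 + C2) * (‖x‖ ^ 2)⁻¹ := hsum
        _ ≤ (C0 + C1 + C2) * (4 * ((1 + ‖x‖) ^ 2)⁻¹) :=
            mul_le_mul_of_nonneg_left hcmp (by positivity)
        _ = 4 * (C0 + C1 + C2) * ((1 + ‖x‖) ^ 2)⁻¹ := by ring
        _ ≤ Cfin * ((1 + ‖x‖) ^ 2)⁻¹ := by
            refine mul_le_mul_of_nonneg_right ?_ hw0.le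
            rw [hCfin]
            nlinarith [sq_nonneg (1 + 4 * R')]
    · -- near field
      have hb := hB₀ (s, x) ⟨Ioo_subset_Icc_self hs, mem_closedBall_zero_iff.2 hnear.le⟩
      have hone : 1 ≤ (1 + 4 * R') ^ 2 * ((1 + ‖x‖) ^ 2)⁻¹ := by
        rw [← div_eq_mul_inv, one_le_div (by positivity)]
        exact pow_le_pow_left₀ (by positivity) (by linarith) 2
      calc ‖timeDerivWithin S u s x‖ ≤ B₀ := hb
        _ ≤ B₀ * ((1 + 4 * R') ^ 2 * ((1 + ‖x‖) ^ 2)⁻¹) := le_mul_of_one_le_right hB₀0 hone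
        _ = B₀ * (1 + 4 * R') ^ 2 * ((1 + ‖x‖) ^ 2)⁻¹ := by ring
        _ ≤ Cfin * ((1 + ‖x‖) ^ 2)⁻¹ := by
            refine mul_le_mul_of_nonneg_right ?_ hw0.le
            rw [hCfin]
            nlinarith
  -- (4) the endpoints `s = 0` and `s = T₁` by continuity in time
  refine ⟨Cfin, fun s hs x => ?_⟩
  have hcont_s : ContinuousOn (fun r => ‖timeDerivWithin S u r x‖) (Icc 0 T₁) :=
    (hdtc.comp (continuous_id.prodMk continuous_const).continuousOn
      fun r hr => mk_mem_prod (hIS hr) (mem_univ x)).norm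
  have hclI : closure (Ioo 0 T₁) = Icc 0 T₁ := closure_Ioo hT₁0.ne
  exact le_on_closure (f := fun r => ‖timeDerivWithin S u r x‖)
    (g := fun _ => Cfin * ((1 + ‖x‖) ^ 2)⁻¹) (fun r hr => hIoo r hr x) (by rwa [hclI])
    continuousOn_const (by rw [hclI]; exact hs)

end TimeDeriv

end Literature.Analysis.FluidPDE
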